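import Mathlib
import Summits.AtomisticToContinuum.HydrodynamicLimit.Theorems.ImplosionDichotomyDenseExcursionR2Modes

/-!
# Two-sided Grönwall and the `Im Λ`-free energy inequality of the characteristic system (for theorem T4)
# (crux `DenseExcursion`, line `sonic-cavity-renewal`, brick for stub `stub_cavityResolventCk`)

Helper file (`--supports stmt-AtomisticToContinuum-12586`, line lead a2, stub-worker E for `stub_cavityResolventCk`,
theorem T4 `transport_segment` of its decomposition). Two ingredients of the a-priori bound, UNIFORM IN `Im Λ`, for
solutions of the resolvent equation on a non-characteristic segment:

* `gronwallBound_le_exp`, `norm_le_gronwall_two_sided` — generic: if `‖f′‖ ≤ K‖f‖ + ε` on `[a, b]` (`K, ε ≥ 0`) then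
  `‖f x‖ ≤ e^{K(b−a)}(‖f x₀‖ + ε(b − a))` for all `x, x₀ ∈ [a, b]` (Mathlib's right-sided Grönwall bound
  `norm_le_gronwallBound_of_norm_deriv_right_le` from `x₀`, and from `−x₀` for the reflected function; the elementary
  `gronwallBound δ K ε t ≤ e^{KT}(δ + εT)` for `0 ≤ t ≤ T` via `e^{s} − 1 ≤ s e^{s}`);
* `char_energy_deriv_bound` (registered helper) — THE ENERGY INEQUALITY OF THE CHARACTERISTIC SYSTEM. If
  `c₊ p′ = (Λ − b₊₊)p − b₊₋q − σ_p` and `c₋ q′ = −b₋₊p + (Λ − b₋₋)q − σ_q` at a point, with REAL `c±`, `b's`,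
  `|c±| ≥ c₀ > 0`, `|b's| ≤ β`, `‖σ's‖ ≤ σ`, then the derivative `2⟪p, p′⟫ + 2⟪q, q′⟫` of `E = ‖p‖² + ‖q‖²` satisfies
  `|E′| ≤ (2|Re Λ| + 4β + 1)/c₀ · E + 2σ²/c₀` — the imaginary part of `Λ` drops out because `Re(p̄ · Λp) = Re Λ · |p|²`
  (real principal part). This is what makes the transport constants on `[a, b]` uniform in `Im Λ` (exponential only in
  `|Re Λ|`), the form consumed by the matching / Evans-function step (T6) and the `|Im Λ| → ∞` regime (T7).

Sources: folklore (Grönwall 1919; Hartman, *ODE*, Ch. III §1).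
-/

noncomputable section

open Set Filter
open scoped Topology RealInnerProductSpace ComplexConjugate

namespace Summit.AtomisticToContinuum.HydrodynamicLimit.Theorems.SonicCavityRenewal

/-! ## Two-sided Grönwall with an explicit exponential bound -/

/-- THE GRÖNWALL BOUND IS AT MOST `e^{KT}(δ + εT)` on `0 ≤ t ≤ T` (for `δ, ε, K ≥ 0`). [folklore] -/
theorem gronwallBound_le_exp {δ K ε t T : ℝ} (hδ : 0 ≤ δ) (hK : 0 ≤ K) (hε : 0 ≤ ε) (ht : 0 ≤ t) (htT : t ≤ T) :
    gronwallBound δ K ε t ≤ Real.exp (K * T) * (δ + ε * T) := by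
  have hT : 0 ≤ T := ht.trans htT
  have hexp1 : 1 ≤ Real.exp (K * T) := Real.one_le_exp (by positivity)
  have hmono : Real.exp (K * t) ≤ Real.exp (K * T) := Real.exp_le_exp.2 (by nlinarith)
  rcases eq_or_ne K 0 with hK0 | hK0
  · rw [hK0, gronwallBound_K0, zero_mul, Real.exp_zero, one_mul]
    nlinarith
  · have hKpos : 0 < K := lt_of_le_of_ne hK hK0.symm
    rw [gronwallBound_of_K_ne_0 hK0]
    have h1 : Real.exp (K * t) - 1 ≤ K * t * Real.exp (K * t) := by
      -- `e^{s} − 1 ≤ s e^{s}` from `1 − s ≤ e^{−s}`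
      have h := Real.add_one_le_exp (-(K * t))
      have hmul : (-(K * t) + 1) * Real.exp (K * t) ≤ Real.exp (-(K * t)) * Real.exp (K * t) :=
        mul_le_mul_of_nonneg_right h (Real.exp_pos _).le
      rw [← Real.exp_add, neg_add_cancel, Real.exp_zero] at hmul
      nlinarith [hmul, Real.exp_pos (K * t)]
    have h2 : ε / K * (Real.exp (K * t) - 1) ≤ ε * t * Real.exp (K * t) := by
      calc ε / K * (Real.exp (K * t) - 1) ≤ ε / K * (K * t * Real.exp (K * t)) :=
            mul_le_mul_of_nonneg_left h1 (by positivity)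
        _ = ε * t * Real.exp (K * t) := by field_simp
    have h3 : ε * t * Real.exp (K * t) ≤ ε * T * Real.exp (K * T) := by gcongr
    have h4 : δ * Real.exp (K * t) ≤ δ * Real.exp (K * T) := mul_le_mul_of_nonneg_left hmono hδ
    nlinarith

/-- **TWO-SIDED GRÖNWALL ON A SEGMENT.** If `f` is differentiable on `[a, b]` with `‖f′ x‖ ≤ K‖f x‖ + ε` there
(`K, ε ≥ 0`), then for all `x₀, x ∈ [a, b]`: `‖f x‖ ≤ e^{K(b−a)}(‖f x₀‖ + ε(b−a))` (rightwards from `x₀` by Mathlib's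
Grönwall bound, leftwards by the same bound for `y ↦ f(−y)`). [folklore] -/
theorem norm_le_gronwall_two_sided {F : Type*} [NormedAddCommGroup F] [NormedSpace ℝ F] {f f' : ℝ → F}
    {K ε a b x₀ : ℝ} (hK : 0 ≤ K) (hε : 0 ≤ ε) (hx₀ : x₀ ∈ Icc a b) (hf : ∀ x ∈ Icc a b, HasDerivAt f (f' x) x)
    (bound : ∀ x ∈ Icc a b, ‖f' x‖ ≤ K * ‖f x‖ + ε) :
    ∀ x ∈ Icc a b, ‖f x‖ ≤ Real.exp (K * (b - a)) * (‖f x₀‖ + ε * (b - a)) := by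
  intro x hx
  have hab : x₀ - a ≤ b - a := by linarith [hx₀.2]
  rcases le_total x₀ x with hle | hle
  · -- rightwards on `[x₀, b]`
    have hsub : Icc x₀ b ⊆ Icc a b := Icc_subset_Icc hx₀.1 le_rfl
    have hcont : ContinuousOn f (Icc x₀ b) := fun y hy => (hf y (hsub hy)).continuousAt.continuousWithinAt
    have h := norm_le_gronwallBound_of_norm_deriv_right_le (f := f) (f' := f') (δ := ‖f x₀‖) (K := K) (ε := ε)
      (a := x₀) (b := b) hcont (fun y hy => (hf y (hsub (Ico_subset_Icc_self hy))).hasDerivWithinAt) le_rfl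
      (fun y hy => bound y (hsub (Ico_subset_Icc_self hy))) x ⟨hle, hx.2⟩
    exact h.trans (gronwallBound_le_exp (norm_nonneg _) hK hε (by linarith) (by linarith [hx.2, hx₀.1]))
  · -- leftwards on `[a, x₀]`: Grönwall for `y ↦ f (-y)` on `[-x₀, -a]`
    set g : ℝ → F := fun y => f (-y) with hg
    have hsub : ∀ y ∈ Icc (-x₀) (-a), -y ∈ Icc a b := fun y hy =>
      ⟨by linarith [hy.2], by linarith [hy.1, hx₀.2]⟩
    have hgd : ∀ y ∈ Icc (-x₀) (-a), HasDerivAt g ((-1 : ℝ) • f' (-y)) y := fun y hy => by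
      have h := (hf (-y) (hsub y hy)).scomp y (hasDerivAt_neg y)
      simpa [hg, Function.comp_def] using h
    have hcont : ContinuousOn g (Icc (-x₀) (-a)) := fun y hy => (hgd y hy).continuousAt.continuousWithinAt
    have h := norm_le_gronwallBound_of_norm_deriv_right_le (f := g) (f' := fun y => (-1 : ℝ) • f' (-y))
      (δ := ‖f x₀‖) (K := K) (ε := ε) (a := -x₀) (b := -a) hcont
      (fun y hy => (hgd y (Ico_subset_Icc_self hy)).hasDerivWithinAt) (by simp [hg])
      (fun y hy => by
        rw [norm_smul, norm_neg, norm_one, one_mul]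
        exact bound (-y) (hsub y (Ico_subset_Icc_self hy))) (-x) ⟨by linarith, by linarith [hx.1]⟩
    simp only [hg, neg_neg] at h
    exact h.trans (gronwallBound_le_exp (norm_nonneg _) hK hε (by linarith) (by linarith [hx.1, hx₀.2]))

/-! ## The energy inequality of the characteristic system (no `Im Λ`) -/

/-- The real identity behind the energy inequality: from `c·p′ = (Λ − b₁)p − b₂q − s` (real `c, b₁, b₂`),
`c·⟪p, p′⟫ = (Re Λ − b₁)‖p‖² − b₂⟪p, q⟫ − ⟪p, s⟫` (real inner product of `ℂ ≅ ℝ²`). [folklore] -/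
theorem char_energy_identity {Λ p q p' s : ℂ} {c b₁ b₂ : ℝ}
    (h : (c : ℂ) * p' = (Λ - b₁) * p - b₂ * q - s) :
    c * ⟪p, p'⟫ = (Λ.re - b₁) * ‖p‖ ^ 2 - b₂ * ⟪p, q⟫ - ⟪p, s⟫ := by
  have hr := congrArg Complex.re h
  have hi := congrArg Complex.im h
  simp only [Complex.sub_re, Complex.sub_im, Complex.mul_re, Complex.mul_im, Complex.ofReal_re,
    Complex.ofReal_im] at hr hi
  simp only [Complex.inner, Complex.mul_re, Complex.conj_re, Complex.conj_im, Complex.sq_norm, Complex.normSq_apply]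
  linear_combination p.re * hr + p.im * hi

/-- One row of the energy inequality: `c₀·|⟪p, p′⟫| ≤ (|Re Λ| + β)‖p‖² + β‖p‖‖q‖ + σ‖p‖`. [folklore] -/
theorem char_energy_row_bound {Λ p q p' s : ℂ} {c b₁ b₂ c₀ β σ : ℝ} (hc : c₀ ≤ |c|) (hb₁ : |b₁| ≤ β)
    (hb₂ : |b₂| ≤ β) (hs : ‖s‖ ≤ σ) (h : (c : ℂ) * p' = (Λ - b₁) * p - b₂ * q - s) :
    c₀ * |⟪p, p'⟫| ≤ (|Λ.re| + β) * ‖p‖ ^ 2 + β * (‖p‖ * ‖q‖) + σ * ‖p‖ := by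
  have hβ0 : 0 ≤ β := (abs_nonneg _).trans hb₁
  have i := char_energy_identity h
  have h1 : c₀ * |⟪p, p'⟫| ≤ |c| * |⟪p, p'⟫| := mul_le_mul_of_nonneg_right hc (abs_nonneg _)
  have h2 : |c| * |⟪p, p'⟫| = |(Λ.re - b₁) * ‖p‖ ^ 2 - b₂ * ⟪p, q⟫ - ⟪p, s⟫| := by rw [← abs_mul, i]
  have h3 : |⟪p, q⟫| ≤ ‖p‖ * ‖q‖ := abs_real_inner_le_norm p q
  have h4 : |⟪p, s⟫| ≤ σ * ‖p‖ := by
    calc |⟪p, s⟫| ≤ ‖p‖ * ‖s‖ := abs_real_inner_le_norm p s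
      _ ≤ ‖p‖ * σ := by gcongr
      _ = σ * ‖p‖ := mul_comm _ _
  have h5 : |(Λ.re - b₁) * ‖p‖ ^ 2| ≤ (|Λ.re| + β) * ‖p‖ ^ 2 := by
    rw [abs_mul, abs_of_nonneg (sq_nonneg ‖p‖)]
    gcongr
    exact (abs_sub _ _).trans (by linarith)
  have h6 : |b₂ * ⟪p, q⟫| ≤ β * (‖p‖ * ‖q‖) := by
    rw [abs_mul]; exact mul_le_mul hb₂ h3 (abs_nonneg _) hβ0
  have h7 := abs_sub ((Λ.re - b₁) * ‖p‖ ^ 2 - b₂ * ⟪p, q⟫) ⟪p, s⟫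
  have h8 := abs_sub ((Λ.re - b₁) * ‖p‖ ^ 2) (b₂ * ⟪p, q⟫)
  linarith

/-- **Registered helper `char_energy_deriv_bound`: THE `Im Λ`-FREE ENERGY INEQUALITY OF THE CHARACTERISTIC SYSTEM.**
If at a point `c₊·p′ = (Λ − b₊₊)p − b₊₋q − σ_p` and `c₋·q′ = −b₋₊p + (Λ − b₋₋)q − σ_q` with real `c±`, `b's`,
`|c±| ≥ c₀ > 0`, `|b's| ≤ β` and `‖σ_p‖, ‖σ_q‖ ≤ σ`, then the derivative `2⟪p, p′⟫ + 2⟪q, q′⟫` of `‖p‖² + ‖q‖²` is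
bounded by `(2|Re Λ| + 4β + 1)/c₀ · (‖p‖² + ‖q‖²) + 2σ²/c₀`, with NO dependence on `Im Λ`. [folklore] -/
theorem char_energy_deriv_bound : ∀ (Λ p q p' q' sp sq : ℂ) (cp cm bpp bpm bmp bmm c₀ β σ : ℝ), 0 < c₀ → c₀ ≤ |cp| → c₀ ≤ |cm| → |bpp| ≤ β → |bpm| ≤ β → |bmp| ≤ β → |bmm| ≤ β → ‖sp‖ ≤ σ → ‖sq‖ ≤ σ → (cp : ℂ) * p' = (Λ - bpp) * p - bpm * q - sp → (cm : ℂ) * q' = -(bmp : ℂ) * p + (Λ - bmm) * q - sq → |2 * inner ℝ p p' + 2 * inner ℝ q q'| ≤ (2 * |Λ.re| + 4 * β + 1) / c₀ * (‖p‖ ^ 2 + ‖q‖ ^ 2) + 2 * σ ^ 2 / c₀ := by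
  intro Λ p q p' q' sp sq cp cm bpp bpm bmp bmm c₀ β σ hc₀ hcp hcm hpp hpm hmp hmm hsp hsq h₁ h₂
  have hβ0 : 0 ≤ β := (abs_nonneg _).trans hpp
  have hσ0 : 0 ≤ σ := (norm_nonneg _).trans hsp
  have r₁ := char_energy_row_bound hcp hpp hpm hsp h₁
  have h₂' : (cm : ℂ) * q' = (Λ - bmm) * q - bmp * p - sq := by rw [h₂]; ring
  have r₂ := char_energy_row_bound hcm hmm hmp hsq h₂'
  set P := ‖p‖
  set Q := ‖q‖
  have hP : 0 ≤ P := norm_nonneg _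
  have hQ : 0 ≤ Q := norm_nonneg _
  -- `c₀ |2⟪p,p′⟫ + 2⟪q,q′⟫| ≤ (2|Re Λ| + 4β + 1)(P² + Q²) + 2σ²`
  have key : c₀ * |2 * ⟪p, p'⟫ + 2 * ⟪q, q'⟫| ≤ (2 * |Λ.re| + 4 * β + 1) * (P ^ 2 + Q ^ 2) + 2 * σ ^ 2 := by
    have habs : |2 * ⟪p, p'⟫ + 2 * ⟪q, q'⟫| ≤ 2 * |⟪p, p'⟫| + 2 * |⟪q, q'⟫| := by
      calc |2 * ⟪p, p'⟫ + 2 * ⟪q, q'⟫| ≤ |2 * ⟪p, p'⟫| + |2 * ⟪q, q'⟫| := abs_add_le _ _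
        _ = 2 * |⟪p, p'⟫| + 2 * |⟪q, q'⟫| := by
          rw [abs_mul, abs_mul, abs_of_pos (by norm_num : (0 : ℝ) < 2)]
    have hmul : c₀ * |2 * ⟪p, p'⟫ + 2 * ⟪q, q'⟫| ≤ 2 * (c₀ * |⟪p, p'⟫|) + 2 * (c₀ * |⟪q, q'⟫|) := by
      nlinarith [habs, hc₀.le]
    have hPQ : 2 * (P * Q) ≤ P ^ 2 + Q ^ 2 := by nlinarith [sq_nonneg (P - Q)]
    have hσP : 2 * (σ * P) ≤ P ^ 2 + σ ^ 2 := by nlinarith [sq_nonneg (P - σ)]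
    have hσQ : 2 * (σ * Q) ≤ Q ^ 2 + σ ^ 2 := by nlinarith [sq_nonneg (Q - σ)]
    have hQP : Q * P = P * Q := mul_comm _ _
    rw [hQP] at r₂
    nlinarith [r₁, r₂, hPQ, hσP, hσQ, hβ0, abs_nonneg Λ.re, sq_nonneg P, sq_nonneg Q]
  rw [div_mul_eq_mul_div, ← add_div, le_div_iff₀ hc₀]
  linarith

/-! ## The final arithmetic of the transport bound -/

/-- THE ARITHMETIC CLOSING THE TRANSPORT BOUND: if `N² ≤ E ≤ e^{(2ρ+γ)θ}(18A² + 18M²θ)` with `N, A, M, γ, ρ ≥ 0`,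
`θ > 0`, then `N ≤ C·e^{Cρ}·(A + M)` with `C = 18·max(1, θ)·e^{γθ}` (so `C` does not depend on `ρ = |Re Λ|`).
[folklore] -/
theorem transport_bound_arith {N E A M θ γ ρ : ℝ} (hN : 0 ≤ N) (hA : 0 ≤ A) (hM : 0 ≤ M) (hθ : 0 < θ)
    (hγ : 0 ≤ γ) (hρ : 0 ≤ ρ) (hNE : N ^ 2 ≤ E)
    (hE : E ≤ Real.exp ((2 * ρ + γ) * θ) * (18 * A ^ 2 + 18 * M ^ 2 * θ)) :
    N ≤ (18 * max 1 θ * Real.exp (γ * θ)) * Real.exp ((18 * max 1 θ * Real.exp (γ * θ)) * ρ) * (A + M) := by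
  set C : ℝ := 18 * max 1 θ * Real.exp (γ * θ) with hC
  have hmax1 : (1 : ℝ) ≤ max 1 θ := le_max_left _ _
  have hmaxθ : θ ≤ max 1 θ := le_max_right _ _
  have hexp1 : (1 : ℝ) ≤ Real.exp (γ * θ) := Real.one_le_exp (by positivity)
  have hC18 : (18 : ℝ) ≤ C := by
    have : (18 : ℝ) * 1 * 1 ≤ 18 * max 1 θ * Real.exp (γ * θ) := by gcongr
    simpa [hC] using this
  have hC1 : (1 : ℝ) ≤ C := by linarith
  have hC0 : (0 : ℝ) ≤ C := by linarith
  have hθC : θ ≤ C := by nlinarith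
  set e : ℝ := Real.exp (ρ * θ) with he
  have he0 : 0 ≤ e := (Real.exp_pos _).le
  have hsplit : Real.exp ((2 * ρ + γ) * θ) = e ^ 2 * Real.exp (γ * θ) := by
    rw [he, sq, ← Real.exp_add, ← Real.exp_add]; congr 1; ring
  -- `18A² + 18M²θ ≤ 18 max(1,θ) (A + M)²`
  have hsum : 18 * A ^ 2 + 18 * M ^ 2 * θ ≤ 18 * max 1 θ * (A + M) ^ 2 := by
    have h1 : A ^ 2 ≤ max 1 θ * A ^ 2 := le_mul_of_one_le_left (sq_nonneg A) hmax1
    have h2 : M ^ 2 * θ ≤ max 1 θ * M ^ 2 := by nlinarith [sq_nonneg M]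
    nlinarith [mul_nonneg (le_trans zero_le_one hmax1) (mul_nonneg hA hM)]
  have hE' : E ≤ e ^ 2 * (C * (A + M) ^ 2) := by
    calc E ≤ Real.exp ((2 * ρ + γ) * θ) * (18 * A ^ 2 + 18 * M ^ 2 * θ) := hE
      _ ≤ e ^ 2 * Real.exp (γ * θ) * (18 * max 1 θ * (A + M) ^ 2) := by
          rw [hsplit]; exact mul_le_mul_of_nonneg_left hsum (by positivity)
      _ = e ^ 2 * (C * (A + M) ^ 2) := by rw [hC]; ring
  have hsq : N ^ 2 ≤ (C * e * (A + M)) ^ 2 := by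
    have hCC : C ≤ C ^ 2 := by nlinarith
    calc N ^ 2 ≤ E := hNE
      _ ≤ e ^ 2 * (C * (A + M) ^ 2) := hE'
      _ ≤ e ^ 2 * (C ^ 2 * (A + M) ^ 2) := by gcongr
      _ = (C * e * (A + M)) ^ 2 := by ring
  have hN' : N ≤ C * e * (A + M) := by
    have h0 : 0 ≤ C * e * (A + M) := by positivity
    nlinarith [hsq, h0, hN]
  have he' : e ≤ Real.exp (C * ρ) := by
    rw [he]; exact Real.exp_le_exp.2 (by nlinarith)
  calc N ≤ C * e * (A + M) := hN'
    _ ≤ C * Real.exp (C * ρ) * (A + M) := by gcongr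

end Summit.AtomisticToContinuum.HydrodynamicLimit.Theorems.SonicCavityRenewal

end
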